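import Mathlib
import Literature.Topology.FourManifolds.EvenSphereQuotients

/-!
# SO(3) toolkit — stub `stub_so3Toolkit` of the line `Sketch`,
# crux `IsometryAtoms.AtomicLawChargesCrystal` (stmt-AtomisticToContinuum-15778)

Five linear-algebra facts about linear isometries of `ℝ³ = EuclideanSpace ℝ (Fin 3)` consumed as
hypotheses by the stubs `stub_smallPartsCommute` and `stub_finitePointGroup` of the line
("near-identity" means `‖A x - x‖ ≤ ‖x‖ / 2`, which excludes the eigenvalue `-1`):

* T0 `tk_T0`: two members of an infinite set of isometries of `ℝ³` are `ε`-close (the isometries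
  lie in the compact unit ball of the operator space; pigeonhole on a finite `ε/2`-net);
* T1 `tk_T1`: a near-identity isometry of `ℝ³` fixes a unit vector (Euler's axis);
* T2 `tk_T2`: if moreover `A ≠ 1`, its fixed vectors are the multiples of the axis `u`;
* T5 `tk_T5`: two near-identity isometries with a common fixed unit vector commute;
* T7 `tk_T7`: `A - 1` maps `u^⊥` onto `u^⊥` for a near-identity `A ≠ 1` with axis `u`.

Method.  For a linear isometry `F` of a finite-dimensional real inner product space `V`, the
transpose trick `F + 1 = F ∘ (1 + F)*` gives `det (F + 1) = det F · det (F + 1)`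
(`tk_det_add_one`, with `det F* = det F` from `Literature.Topology.FourManifolds`), so a
near-identity `F` (for which `F + 1` is injective) has `det F = 1` (`tk_det_eq_one`); in odd
dimension an isometry without non-zero fixed vectors has `det = -1`
(`Literature.Topology.FourManifolds.det_eq_neg_one_of_forall_map_eq_self`), whence T1.  A
near-identity `A` fixing `u` preserves the plane
`K = (ℝ ∙ u)ᗮ`, and its restriction is a near-identity isometry of `K`, of determinant `1`, hence
`o.rotation θ` for any orientation `o` of `K` (`tk_plane`, via
`Orientation.exists_linearIsometryEquiv_eq_of_det_pos`); `θ = 0` forces `A = 1` (`tk_fix_all`).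
T2: a fixed `k ∈ K` of a rotation by `θ ≠ 0` is `0`.  T5: rotations of `K` compose additively.
T7: `rotation θ - 1` is injective on `K` for `θ ≠ 0`, hence surjective.

References: S. L. Altmann, *Rotations, quaternions, and double groups* (1986), Ch. 3 (Euler's
theorem on the axis of a rotation); folklore linear algebra.
-/

noncomputable section

open Module

namespace Summit.AtomisticToContinuum.Crystallization.Theorems.IsometryAtomsAtomicLawChargesCrystal

variable {V : Type*} [NormedAddCommGroup V] [InnerProductSpace ℝ V] [FiniteDimensional ℝ V]

/-- **Transpose trick.** For a linear isometry `F` of `V`, `det (F + 1) = det F * det (F + 1)`,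
because `F + 1 = F ∘ (1 + F)*` (`F F* = 1`) and `det (1 + F)* = det (1 + F)`. -/
theorem tk_det_add_one (F : V ≃ₗᵢ[ℝ] V) :
    LinearMap.det ((F.toLinearEquiv : V →ₗ[ℝ] V) + 1) =
      LinearMap.det (F.toLinearEquiv : V →ₗ[ℝ] V) *
        LinearMap.det ((F.toLinearEquiv : V →ₗ[ℝ] V) + 1) := by
  set f : V →ₗ[ℝ] V := (F.toLinearEquiv : V →ₗ[ℝ] V) with hf
  have hadj : LinearMap.adjoint f = (F.symm.toLinearEquiv : V →ₗ[ℝ] V) :=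
    F.adjoint_toLinearMap_eq_symm
  have h1 : f * LinearMap.adjoint f = 1 := by
    rw [hadj]
    ext x
    simp [hf]
  have h2 : f + 1 = f * LinearMap.adjoint (1 + f) := by
    rw [map_add, LinearMap.adjoint_one, mul_add, mul_one, h1, add_comm]
  conv_lhs => rw [h2]
  rw [map_mul, Literature.Topology.FourManifolds.det_adjoint_eq_det, add_comm (1 : V →ₗ[ℝ] V) f]

omit [FiniteDimensional ℝ V] in
/-- A vector `v` with `F v = -v` of a near-identity isometry `F` vanishes. -/
theorem tk_eq_zero_of_map_eq_neg (F : V ≃ₗᵢ[ℝ] V) (hF : ∀ x : V, ‖F x - x‖ ≤ ‖x‖ / 2) {v : V}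
    (hv : F v = -v) : v = 0 := by
  have h := hF v
  rw [hv, ← neg_add', norm_neg, ← two_smul ℝ v, norm_smul, Real.norm_two] at h
  have : ‖v‖ = 0 := by linarith [norm_nonneg v]
  exact norm_eq_zero.1 this

/-- A near-identity linear isometry has determinant `1`: by the transpose trick
`det (F + 1) = det F * det (F + 1)`, and `F + 1` is injective. -/
theorem tk_det_eq_one (F : V ≃ₗᵢ[ℝ] V) (hF : ∀ x : V, ‖F x - x‖ ≤ ‖x‖ / 2) :
    LinearMap.det (F.toLinearEquiv : V →ₗ[ℝ] V) = 1 := by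
  have h := tk_det_add_one F
  have hne : LinearMap.det ((F.toLinearEquiv : V →ₗ[ℝ] V) + 1) ≠ 0 := by
    intro h0
    obtain ⟨v, hv, hv0⟩ :=
      (Submodule.ne_bot_iff _).1 (bot_lt_iff_ne_bot.1 (LinearMap.bot_lt_ker_of_det_eq_zero h0))
    rw [LinearMap.mem_ker, LinearMap.add_apply, Module.End.one_apply,
      add_eq_zero_iff_eq_neg] at hv
    exact hv0 (tk_eq_zero_of_map_eq_neg F hF (by simpa using hv))
  exact (mul_eq_right₀ hne).1 h.symm

omit [FiniteDimensional ℝ V] in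
/-- The component of `x` orthogonal to a unit vector `u` lies in `(ℝ ∙ u)ᗮ`. -/
theorem tk_perp_mem {u : V} (hu : ‖u‖ = 1) (x : V) : x - (inner ℝ u x) • u ∈ (ℝ ∙ u)ᗮ := by
  rw [Submodule.mem_orthogonal_singleton_iff_inner_right, inner_sub_right, inner_smul_right,
    real_inner_self_eq_norm_sq, hu]
  ring

omit [FiniteDimensional ℝ V] in
/-- A linear isometry fixing the unit vector `u` and every vector of `(ℝ ∙ u)ᗮ` is the identity. -/
theorem tk_fix_all (A : V ≃ₗᵢ[ℝ] V) {u : V} (hu : ‖u‖ = 1) (hAu : A u = u)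
    (h : ∀ k ∈ (ℝ ∙ u)ᗮ, A k = k) (x : V) : A x = x := by
  have hk := h _ (tk_perp_mem hu x)
  rwa [map_sub, map_smul, hAu, sub_left_inj] at hk

/-- **A near-identity isometry is a rotation of the plane `u^⊥`.** If the near-identity linear
isometry `A` fixes `u` and `(ℝ ∙ u)ᗮ` is a plane, then for every orientation `o` of that plane
`A` acts on it as `o.rotation θ` for some angle `θ` (`A` preserves `(ℝ ∙ u)ᗮ`; its restriction is
a near-identity isometry, hence of determinant `1`). -/
theorem tk_plane (A : V ≃ₗᵢ[ℝ] V) (hA : ∀ x : V, ‖A x - x‖ ≤ ‖x‖ / 2) {u : V} (hAu : A u = u)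
    [Fact (finrank ℝ (ℝ ∙ u)ᗮ = 2)] (o : Orientation ℝ (ℝ ∙ u)ᗮ (Fin 2)) :
    ∃ θ : Real.Angle, ∀ k : (ℝ ∙ u)ᗮ, A k = o.rotation θ k := by
  have hmap : ∀ k ∈ (ℝ ∙ u)ᗮ, (A.toLinearEquiv : V →ₗ[ℝ] V) k ∈ (ℝ ∙ u)ᗮ := by
    intro k hk
    rw [Submodule.mem_orthogonal_singleton_iff_inner_right] at hk ⊢
    rw [LinearEquiv.coe_coe, LinearIsometryEquiv.coe_toLinearEquiv, ← hAu,
      LinearIsometryEquiv.inner_map_map]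
    exact hk
  let fi : (ℝ ∙ u)ᗮ →ₗᵢ[ℝ] (ℝ ∙ u)ᗮ :=
    ⟨(A.toLinearEquiv : V →ₗ[ℝ] V).restrict hmap, fun k => by
      rw [Submodule.coe_norm, Submodule.coe_norm, LinearMap.coe_restrict_apply]
      exact A.norm_map k⟩
  let F : (ℝ ∙ u)ᗮ ≃ₗᵢ[ℝ] (ℝ ∙ u)ᗮ := fi.toLinearIsometryEquiv rfl
  have hF : ∀ k : (ℝ ∙ u)ᗮ, (F k : V) = A k := fun k => rfl
  have hFsmall : ∀ k : (ℝ ∙ u)ᗮ, ‖F k - k‖ ≤ ‖k‖ / 2 := fun k => by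
    rw [Submodule.coe_norm, Submodule.coe_norm, Submodule.coe_sub, hF]
    exact hA k
  obtain ⟨θ, hθ⟩ := o.exists_linearIsometryEquiv_eq_of_det_pos (f := F)
    (by rw [tk_det_eq_one F hFsmall]; exact one_pos)
  exact ⟨θ, fun k => by rw [← hF, hθ]⟩

/-- **T0 — accumulation in an infinite set of isometries of `ℝ³`.** The linear isometries embed
in the unit ball of the (finite-dimensional, proper) operator space, which finitely many
`ε/2`-balls cover; two members of an infinite set fall into the same ball (pigeonhole). -/
theorem tk_T0 : ∀ S : Set (EuclideanSpace ℝ (Fin 3) ≃ₗᵢ[ℝ] EuclideanSpace ℝ (Fin 3)),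
    S.Infinite → ∀ ε : ℝ, 0 < ε → ∃ A ∈ S, ∃ B ∈ S, A ≠ B ∧
      ∀ x : EuclideanSpace ℝ (Fin 3), ‖A x - B x‖ ≤ ε * ‖x‖ := by
  intro S hS ε hε
  obtain ⟨t, -, htfin, hcover⟩ := finite_cover_balls_of_compact
    (isCompact_closedBall (0 : EuclideanSpace ℝ (Fin 3) →L[ℝ] EuclideanSpace ℝ (Fin 3)) 1)
    (half_pos hε)
  have hmem : ∀ A : EuclideanSpace ℝ (Fin 3) ≃ₗᵢ[ℝ] EuclideanSpace ℝ (Fin 3),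
      (A : EuclideanSpace ℝ (Fin 3) →L[ℝ] EuclideanSpace ℝ (Fin 3)) ∈
        Metric.closedBall (0 : EuclideanSpace ℝ (Fin 3) →L[ℝ] EuclideanSpace ℝ (Fin 3)) 1 := by
    intro A
    rw [Metric.mem_closedBall, dist_zero_right]
    exact ContinuousLinearMap.opNorm_le_bound _ zero_le_one fun x => by simp
  have hc : ∀ A : EuclideanSpace ℝ (Fin 3) ≃ₗᵢ[ℝ] EuclideanSpace ℝ (Fin 3), ∃ c ∈ t,
      (A : EuclideanSpace ℝ (Fin 3) →L[ℝ] EuclideanSpace ℝ (Fin 3)) ∈ Metric.ball c (ε / 2) := by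
    intro A
    simpa only [Set.mem_iUnion, exists_prop] using hcover (hmem A)
  choose c hct hcA using hc
  obtain ⟨A, hA, B, hB, hAB, hcAB⟩ := hS.exists_ne_map_eq_of_mapsTo (fun A _ => hct A) htfin
  refine ⟨A, hA, B, hB, hAB, fun x => ?_⟩
  have hdist : ‖(A : EuclideanSpace ℝ (Fin 3) →L[ℝ] EuclideanSpace ℝ (Fin 3)) -
      (B : EuclideanSpace ℝ (Fin 3) →L[ℝ] EuclideanSpace ℝ (Fin 3))‖ ≤ ε := by
    have h1 := hcA A
    have h2 := hcA B
    rw [hcAB] at h1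
    rw [Metric.mem_ball] at h1 h2
    rw [← dist_eq_norm]
    linarith [dist_triangle_right
      (A : EuclideanSpace ℝ (Fin 3) →L[ℝ] EuclideanSpace ℝ (Fin 3))
      (B : EuclideanSpace ℝ (Fin 3) →L[ℝ] EuclideanSpace ℝ (Fin 3)) (c B)]
  calc ‖A x - B x‖ = ‖((A : EuclideanSpace ℝ (Fin 3) →L[ℝ] EuclideanSpace ℝ (Fin 3)) -
        (B : EuclideanSpace ℝ (Fin 3) →L[ℝ] EuclideanSpace ℝ (Fin 3))) x‖ := rfl
    _ ≤ ‖(A : EuclideanSpace ℝ (Fin 3) →L[ℝ] EuclideanSpace ℝ (Fin 3)) -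
        (B : EuclideanSpace ℝ (Fin 3) →L[ℝ] EuclideanSpace ℝ (Fin 3))‖ * ‖x‖ :=
        ContinuousLinearMap.le_opNorm _ _
    _ ≤ ε * ‖x‖ := by gcongr

/-- **T1 — a near-identity isometry of `ℝ³` fixes a unit vector.** Its determinant is `1`
(`tk_det_eq_one`), while an isometry of the odd-dimensional `ℝ³` without non-zero fixed vectors
has determinant `-1` (`Literature.Topology.FourManifolds.det_eq_neg_one_of_forall_map_eq_self`);
normalise a non-zero fixed vector. -/
theorem tk_T1 : ∀ A : EuclideanSpace ℝ (Fin 3) ≃ₗᵢ[ℝ] EuclideanSpace ℝ (Fin 3),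
    (∀ x : EuclideanSpace ℝ (Fin 3), ‖A x - x‖ ≤ ‖x‖ / 2) →
      ∃ u : EuclideanSpace ℝ (Fin 3), ‖u‖ = 1 ∧ A u = u := by
  intro A hA
  have hodd : Odd (finrank ℝ (EuclideanSpace ℝ (Fin 3))) := by
    rw [finrank_euclideanSpace_fin]
    exact ⟨1, rfl⟩
  by_contra hne
  push Not at hne
  have hfix : ∀ v : EuclideanSpace ℝ (Fin 3), A v = v → v = 0 := by
    intro v hv
    by_contra hv0
    have hn : ‖v‖ ≠ 0 := norm_ne_zero_iff.2 hv0
    refine hne (‖v‖⁻¹ • v) ?_ ?_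
    · rw [norm_smul, norm_inv, norm_norm, inv_mul_cancel₀ hn]
    · rw [map_smul, hv]
  have h := Literature.Topology.FourManifolds.det_eq_neg_one_of_forall_map_eq_self hodd A hfix
  rw [tk_det_eq_one A hA] at h
  norm_num at h

/-- The plane `(ℝ ∙ u)ᗮ` of a unit vector `u` of `ℝ³` has dimension `2`. -/
theorem tk_fact_finrank_two {u : EuclideanSpace ℝ (Fin 3)} (hu : ‖u‖ = 1) :
    Fact (finrank ℝ (ℝ ∙ u)ᗮ = 2) := by
  have hu0 : u ≠ 0 := by
    rintro rfl
    simp at hu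
  haveI : Fact (finrank ℝ (EuclideanSpace ℝ (Fin 3)) = 2 + 1) := ⟨by simp⟩
  exact ⟨Submodule.finrank_orthogonal_span_singleton hu0⟩

/-- If a near-identity isometry `A ≠ 1` of `ℝ³` fixes the unit vector `u` and acts on `(ℝ ∙ u)ᗮ`
as `o.rotation θ`, then `θ ≠ 0`. -/
theorem tk_angle_ne_zero (A : EuclideanSpace ℝ (Fin 3) ≃ₗᵢ[ℝ] EuclideanSpace ℝ (Fin 3))
    {u : EuclideanSpace ℝ (Fin 3)} (hu : ‖u‖ = 1) (hAu : A u = u)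
    (hne : ∃ x : EuclideanSpace ℝ (Fin 3), A x ≠ x) [Fact (finrank ℝ (ℝ ∙ u)ᗮ = 2)]
    (o : Orientation ℝ (ℝ ∙ u)ᗮ (Fin 2)) {θ : Real.Angle}
    (hθ : ∀ k : (ℝ ∙ u)ᗮ, A k = o.rotation θ k) : θ ≠ 0 := by
  intro h0
  obtain ⟨x, hx⟩ := hne
  refine hx (tk_fix_all A hu hAu (fun k hk => ?_) x)
  have := hθ ⟨k, hk⟩
  rw [h0, o.rotation_zero] at this
  simpa using this

/-- **T2 — the fixed space of a near-identity isometry `A ≠ 1` of `ℝ³` with axis `u` is `ℝ u`.**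
The component `k ∈ u^⊥` of a fixed vector is fixed by the rotation `A|u^⊥ = o.rotation θ` with
`θ ≠ 0`, hence `k = 0`. -/
theorem tk_T2 : ∀ A : EuclideanSpace ℝ (Fin 3) ≃ₗᵢ[ℝ] EuclideanSpace ℝ (Fin 3),
    (∀ x : EuclideanSpace ℝ (Fin 3), ‖A x - x‖ ≤ ‖x‖ / 2) → ∀ u : EuclideanSpace ℝ (Fin 3),
      ‖u‖ = 1 → A u = u → (∃ x : EuclideanSpace ℝ (Fin 3), A x ≠ x) →
        ∀ v : EuclideanSpace ℝ (Fin 3), A v = v → ∃ c : ℝ, v = c • u := by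
  intro A hA u hu hAu hne v hv
  haveI := tk_fact_finrank_two hu
  let o : Orientation ℝ (ℝ ∙ u)ᗮ (Fin 2) :=
    (Module.finBasisOfFinrankEq ℝ (ℝ ∙ u)ᗮ Fact.out).orientation
  obtain ⟨θ, hθ⟩ := tk_plane A hA hAu o
  have hθ0 := tk_angle_ne_zero A hu hAu hne o hθ
  set k : (ℝ ∙ u)ᗮ := ⟨v - (inner ℝ u v) • u, tk_perp_mem hu v⟩ with hk
  have hAk : A (k : EuclideanSpace ℝ (Fin 3)) = k := by
    simp only [hk, map_sub, map_smul, hAu, hv]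
  have hrot : o.rotation θ k = k := Subtype.ext (by rw [← hθ k, hAk])
  rcases (o.rotation_eq_self_iff k θ).1 hrot with hk0 | h0
  · refine ⟨inner ℝ u v, ?_⟩
    have : (k : EuclideanSpace ℝ (Fin 3)) = 0 := by rw [hk0, Submodule.coe_zero]
    exact sub_eq_zero.1 this
  · exact absurd h0 hθ0

/-- **T5 — two near-identity isometries of `ℝ³` with a common fixed unit vector commute.** Both
act on `u^⊥` as rotations `o.rotation α`, `o.rotation β` for one orientation `o`, and rotations of
a plane commute (`Orientation.rotation_rotation`); decompose `x = ⟪u, x⟫ u + k`. -/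
theorem tk_T5 : ∀ A B : EuclideanSpace ℝ (Fin 3) ≃ₗᵢ[ℝ] EuclideanSpace ℝ (Fin 3),
    (∀ x : EuclideanSpace ℝ (Fin 3), ‖A x - x‖ ≤ ‖x‖ / 2) →
      (∀ x : EuclideanSpace ℝ (Fin 3), ‖B x - x‖ ≤ ‖x‖ / 2) → ∀ u : EuclideanSpace ℝ (Fin 3),
        ‖u‖ = 1 → A u = u → B u = u → ∀ x : EuclideanSpace ℝ (Fin 3), A (B x) = B (A x) := by
  intro A B hA hB u hu hAu hBu x
  haveI := tk_fact_finrank_two hu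
  let o : Orientation ℝ (ℝ ∙ u)ᗮ (Fin 2) :=
    (Module.finBasisOfFinrankEq ℝ (ℝ ∙ u)ᗮ Fact.out).orientation
  obtain ⟨α, hα⟩ := tk_plane A hA hAu o
  obtain ⟨β, hβ⟩ := tk_plane B hB hBu o
  obtain ⟨c, k, rfl⟩ : ∃ (c : ℝ) (k : (ℝ ∙ u)ᗮ), x = c • u + k :=
    ⟨inner ℝ u x, ⟨x - (inner ℝ u x) • u, tk_perp_mem hu x⟩, by simp⟩
  simp only [map_add, map_smul, hAu, hBu, hα, hβ, o.rotation_rotation]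
  rw [add_comm α β]

/-- **T7 — `A - 1` maps `u^⊥` onto `u^⊥`** for a near-identity isometry `A ≠ 1` of `ℝ³` with axis
`u`: on the plane `u^⊥`, `A - 1 = o.rotation θ - 1` with `θ ≠ 0` is injective, hence surjective. -/
theorem tk_T7 : ∀ A : EuclideanSpace ℝ (Fin 3) ≃ₗᵢ[ℝ] EuclideanSpace ℝ (Fin 3),
    (∀ x : EuclideanSpace ℝ (Fin 3), ‖A x - x‖ ≤ ‖x‖ / 2) → ∀ u : EuclideanSpace ℝ (Fin 3),
      ‖u‖ = 1 → A u = u → (∃ x : EuclideanSpace ℝ (Fin 3), A x ≠ x) →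
        ∀ w : EuclideanSpace ℝ (Fin 3), inner ℝ w u = 0 →
          ∃ c : EuclideanSpace ℝ (Fin 3), inner ℝ c u = 0 ∧ A c - c = w := by
  intro A hA u hu hAu hne w hw
  haveI := tk_fact_finrank_two hu
  let o : Orientation ℝ (ℝ ∙ u)ᗮ (Fin 2) :=
    (Module.finBasisOfFinrankEq ℝ (ℝ ∙ u)ᗮ Fact.out).orientation
  obtain ⟨θ, hθ⟩ := tk_plane A hA hAu o
  have hθ0 := tk_angle_ne_zero A hu hAu hne o hθ
  let G : (ℝ ∙ u)ᗮ →ₗ[ℝ] (ℝ ∙ u)ᗮ :=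
    ((o.rotation θ).toLinearEquiv : (ℝ ∙ u)ᗮ →ₗ[ℝ] (ℝ ∙ u)ᗮ) - LinearMap.id
  have hG : ∀ k : (ℝ ∙ u)ᗮ, G k = o.rotation θ k - k := fun k => rfl
  have hGinj : Function.Injective G := by
    rw [← LinearMap.ker_eq_bot, Submodule.eq_bot_iff]
    intro k hk
    rw [LinearMap.mem_ker, hG, sub_eq_zero] at hk
    rcases (o.rotation_eq_self_iff k θ).1 hk with h | h
    · exact h
    · exact absurd h hθ0
  have hwK : w ∈ (ℝ ∙ u)ᗮ := Submodule.mem_orthogonal_singleton_iff_inner_left.2 hw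
  obtain ⟨k, hk⟩ := LinearMap.injective_iff_surjective.1 hGinj ⟨w, hwK⟩
  refine ⟨k, Submodule.mem_orthogonal_singleton_iff_inner_left.1 k.2, ?_⟩
  have := congrArg Subtype.val hk
  rw [hG, Submodule.coe_sub, ← hθ k] at this
  exact this

/-- **SO(3) toolkit** (registered stub `stub_so3Toolkit` of the line `Sketch`): the conjunction
of T0 (accumulation in an infinite set of isometries of `ℝ³`), T1 (a near-identity isometry has a
fixed unit vector), T2 (its fixed space is the axis when it is not the identity), T5 (two
near-identity isometries with a common axis commute) and T7 (`A - 1` maps `u^⊥` onto `u^⊥`). -/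
theorem stub_so3Toolkit :
    (∀ S : Set (EuclideanSpace ℝ (Fin 3) ≃ₗᵢ[ℝ] EuclideanSpace ℝ (Fin 3)), S.Infinite → ∀ ε : ℝ, 0 < ε → ∃ A ∈ S, ∃ B ∈ S, A ≠ B ∧ ∀ x : EuclideanSpace ℝ (Fin 3), ‖A x - B x‖ ≤ ε * ‖x‖) ∧
    (∀ A : EuclideanSpace ℝ (Fin 3) ≃ₗᵢ[ℝ] EuclideanSpace ℝ (Fin 3), (∀ x : EuclideanSpace ℝ (Fin 3), ‖A x - x‖ ≤ ‖x‖ / 2) → ∃ u : EuclideanSpace ℝ (Fin 3), ‖u‖ = 1 ∧ A u = u) ∧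
    (∀ A : EuclideanSpace ℝ (Fin 3) ≃ₗᵢ[ℝ] EuclideanSpace ℝ (Fin 3), (∀ x : EuclideanSpace ℝ (Fin 3), ‖A x - x‖ ≤ ‖x‖ / 2) → ∀ u : EuclideanSpace ℝ (Fin 3), ‖u‖ = 1 → A u = u → (∃ x : EuclideanSpace ℝ (Fin 3), A x ≠ x) → ∀ v : EuclideanSpace ℝ (Fin 3), A v = v → ∃ c : ℝ, v = c • u) ∧
    (∀ A B : EuclideanSpace ℝ (Fin 3) ≃ₗᵢ[ℝ] EuclideanSpace ℝ (Fin 3), (∀ x : EuclideanSpace ℝ (Fin 3), ‖A x - x‖ ≤ ‖x‖ / 2) → (∀ x : EuclideanSpace ℝ (Fin 3), ‖B x - x‖ ≤ ‖x‖ / 2) → ∀ u : EuclideanSpace ℝ (Fin 3), ‖u‖ = 1 → A u = u → B u = u → ∀ x : EuclideanSpace ℝ (Fin 3), A (B x) = B (A x)) ∧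
    (∀ A : EuclideanSpace ℝ (Fin 3) ≃ₗᵢ[ℝ] EuclideanSpace ℝ (Fin 3), (∀ x : EuclideanSpace ℝ (Fin 3), ‖A x - x‖ ≤ ‖x‖ / 2) → ∀ u : EuclideanSpace ℝ (Fin 3), ‖u‖ = 1 → A u = u → (∃ x : EuclideanSpace ℝ (Fin 3), A x ≠ x) → ∀ w : EuclideanSpace ℝ (Fin 3), inner ℝ w u = 0 → ∃ c : EuclideanSpace ℝ (Fin 3), inner ℝ c u = 0 ∧ A c - c = w) :=
  ⟨tk_T0, tk_T1, tk_T2, tk_T5, tk_T7⟩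

end Summit.AtomisticToContinuum.Crystallization.Theorems.IsometryAtomsAtomicLawChargesCrystal

end
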